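import Summits.Ventures.PercRepro.ProfilePointedMovesLevel
import Mathlib.Combinatorics.Hall.Finite

/-!
# PercRepro — (C1′) AS A CONTAINMENT MATCHING: THE SUPERSET CLOSURE OF `𝒦` AND THE CONJECTURE (SUP)
(p10, gen 17; `proofs/P10-AVFULL.md` §25)

For a finite matroid `M` on `N = #E` elements and a point `p`, `𝒦 = capSets M p` is the family of `p`-avoiding
bi-independent sets capturing `p` (`X` independent, `E ∖ X` independent, `p ∈ cl X`), `𝒦_k` its level-`k` slice
(`capLevel`, of cardinality `κ_k = capCount M k p`).  The coloop limit (C1′) `N · Σ_k κ_k ≤ 2 · Σ_k k · κ_k`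
(`CapLimit`) follows from (SYM) `κ_k ≤ κ_{N−k}` for `2k < N` (`CapSym`; `capLimit_of_capSym`, gen 15).

THE SUPERSET CLOSURE (theorem, `mem_capSets_of_subset`): an independent superset of a captured set, avoiding `p`,
is again captured — `p ∈ cl X ⊆ cl X'` and `E ∖ X' ⊆ E ∖ X` is independent.  So the up-set of `X ∈ 𝒦` inside the
`p`-avoiding independent sets lies entirely in `𝒦`, and (SYM) has a natural STRUCTURAL strengthening:

  (SUP)  for every `2k < N` the containment graph `𝒦_k → 𝒦_{N−k}` (`X ⊆ X'`) has a matching saturating `𝒦_k`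

(`CapSup`: an injection `f` on `𝒦_k` with `X ⊆ f X ∈ 𝒦_{N−k}`; `CapSupHall`: Hall's condition — every `𝒜 ⊆ 𝒦_k`
has at least `#𝒜` captured supersets at level `N − k`).  Proved here: `CapSup ↔ CapSupHall` (Mathlib's Hall theorem
`Finset.all_card_le_biUnion_card_iff_existsInjective'`), `CapSup → CapSym` (`card_le_card_of_injOn`) and hence
`CapSup → CapLimit`.  Census (gen 17, `mining/p10/g17/`): (SUP) holds at every level of every `(M, p)` with `𝒦 ≠ ∅`
on every matroid with ≤ 8 elements (51 / 213 / 717 / 8,333 `(M, p)` at `n = 5 … 8`, 0 failures; the `n = 9`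
catalogue by kit); by contrast the COMPLEMENT rule `X ↦ X' ⊇ E ∖ X − p` fails already at `n = 5`, and no fixed
greedy choice of the superset is injective.  Nothing here asserts (SUP), (SYM) or (C1′).
-/

open scoped Matroid

namespace PercRepro.Cogirth

open Finset ThmH Skew

variable {α : Type} [DecidableEq α] {M : Matroid α} [M.Finite]

/-- `𝒦_k`: the level-`k` slice of the captured family. -/
noncomputable def capLevel (M : Matroid α) [M.Finite] (p : α) (k : ℕ) : Finset (Finset α) :=
  (capSets M p).filter (fun X => X.card = k)

/-- Membership in `𝒦_k`. -/
theorem mem_capLevel {p : α} {k : ℕ} {X : Finset α} :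
    X ∈ capLevel M p k ↔ X ∈ capSets M p ∧ X.card = k := by
  unfold capLevel
  rw [mem_filter]

/-- `#𝒦_k = κ_k`. -/
theorem card_capLevel (p : α) (k : ℕ) : (capLevel M p k).card = capCount M k p :=
  card_capSets_filter p k

/-- **THE SUPERSET CLOSURE OF `𝒦`**: an independent superset `X' ⊇ X` of a captured set, inside the ground set
and avoiding `p`, is again captured (`p ∈ cl X ⊆ cl X'`; `E ∖ X' ⊆ E ∖ X` is independent). -/
theorem mem_capSets_of_subset {p : α} {X X' : Finset α} (hX : X ∈ capSets M p) (hXX' : X ⊆ X')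
    (hX'g : X' ⊆ gr M) (hpX' : p ∉ X') (hind : rk M X' = X'.card) : X' ∈ capSets M p := by
  rw [mem_capSets] at hX ⊢
  obtain ⟨⟨hXbi, _⟩, hpcl⟩ := hX
  rw [mem_biIndepAll] at hXbi
  obtain ⟨_, _, hXc⟩ := hXbi
  refine ⟨⟨?_, hpX'⟩, mem_clF_of_subset hXX' hpcl⟩
  rw [mem_biIndepAll]
  refine ⟨hX'g, hind, ?_⟩
  exact rk_eq_card_of_subset_of_rk_eq_card (sdiff_subset_sdiff (Subset.refl _) hXX') hXc

/-- **(SUP) (NOT asserted)**: for every finite matroid on `α`, every point `p` and every level `2k < N`, the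
containment graph `𝒦_k → 𝒦_{N−k}` has a matching saturating `𝒦_k` — an injection `f` on `𝒦_k` with
`X ⊆ f X ∈ 𝒦_{N−k}`. -/
def CapSup (α : Type) [DecidableEq α] : Prop :=
  ∀ (M : Matroid α) [M.Finite] (p : α) (k : ℕ), p ∈ gr M → 2 * k < (gr M).card →
    ∃ f : Finset α → Finset α, Set.InjOn f (capLevel M p k) ∧
      ∀ X ∈ capLevel M p k, f X ∈ capLevel M p ((gr M).card - k) ∧ X ⊆ f X

/-- **(SUP), HALL FORM (NOT asserted)**: every subfamily `𝒜 ⊆ 𝒦_k` (`2k < N`) has at least `#𝒜` captured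
supersets at the mirror level `N − k`. -/
def CapSupHall (α : Type) [DecidableEq α] : Prop :=
  ∀ (M : Matroid α) [M.Finite] (p : α) (k : ℕ), p ∈ gr M → 2 * k < (gr M).card →
    ∀ 𝒜 ⊆ capLevel M p k,
      𝒜.card ≤ ((capLevel M p ((gr M).card - k)).filter (fun X' => ∃ X ∈ 𝒜, X ⊆ X')).card

/-- (SUP) ⟹ (SYM): the injection `𝒦_k → 𝒦_{N−k}` gives `κ_k ≤ κ_{N−k}`. -/
theorem capSym_of_capSup (h : CapSup α) : CapSym α := by
  intro M _ p k hp hk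
  obtain ⟨f, hinj, hf⟩ := h M p k hp hk
  rw [← card_capLevel, ← card_capLevel]
  exact card_le_card_of_injOn f (fun X hX => (hf X hX).1) hinj

/-- (SUP) ⟹ (C1′), through (SYM). -/
theorem capLimit_of_capSup (h : CapSup α) : CapLimit α :=
  capLimit_of_capSym (capSym_of_capSup h)

/-- The injection form of (SUP) gives the Hall form: the image of `𝒜` under `f` consists of captured supersets
at level `N − k`, and `f` is injective on `𝒜`. -/
theorem capSupHall_of_capSup (h : CapSup α) : CapSupHall α := by
  intro M _ p k hp hk 𝒜 h𝒜
  obtain ⟨f, hinj, hf⟩ := h M p k hp hk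
  apply card_le_card_of_injOn f
  · intro X hX
    have hX' : X ∈ 𝒜 := hX
    have hXk : X ∈ capLevel M p k := h𝒜 hX'
    rw [mem_coe, mem_filter]
    exact ⟨(hf X hXk).1, X, hX', (hf X hXk).2⟩
  · exact hinj.mono (fun X hX => h𝒜 hX)

/-- The Hall form of (SUP) gives the injection form (Mathlib's Hall theorem on the subtype `𝒦_k`). -/
theorem capSup_of_capSupHall (h : CapSupHall α) : CapSup α := by
  intro M _ p k hp hk
  have hH := h M p k hp hk
  let T : Finset (Finset α) := capLevel M p ((gr M).card - k)
  let t : {X // X ∈ capLevel M p k} → Finset (Finset α) := fun X => T.filter (fun X' => X.1 ⊆ X')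
  have hall : ∀ s : Finset {X // X ∈ capLevel M p k}, s.card ≤ (s.biUnion t).card := by
    intro s
    have h1 := hH (s.map (Function.Embedding.subtype _)) (by
      intro X hX
      rw [mem_map] at hX
      obtain ⟨Y, _, rfl⟩ := hX
      exact Y.2)
    rw [card_map] at h1
    refine h1.trans (card_le_card ?_)
    intro X' hX'
    rw [mem_filter] at hX'
    obtain ⟨hX'T, Y, hY, hYX'⟩ := hX'
    rw [mem_map] at hY
    obtain ⟨Z, hZ, rfl⟩ := hY
    rw [mem_biUnion]
    refine ⟨Z, hZ, ?_⟩
    simp only [t, mem_filter]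
    exact ⟨hX'T, hYX'⟩
  obtain ⟨f, hfinj, hft⟩ := (all_card_le_biUnion_card_iff_existsInjective' t).1 hall
  refine ⟨fun X => if hX : X ∈ capLevel M p k then f ⟨X, hX⟩ else X, ?_, ?_⟩
  · intro X hX Y hY hXY
    have hX' : X ∈ capLevel M p k := hX
    have hY' : Y ∈ capLevel M p k := hY
    dsimp only at hXY
    rw [dif_pos hX', dif_pos hY'] at hXY
    exact congrArg Subtype.val (hfinj hXY)
  · intro X hX
    dsimp only
    rw [dif_pos hX]
    have h1 := hft ⟨X, hX⟩
    simp only [t, mem_filter] at h1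
    exact h1

/-- **EVERY SOURCE HAS A TARGET**: a captured `k`-set with `2k < N` has a captured superset at the mirror level
`N − k` — the rank of `E − p` is at least `N − k` (`E ∖ X` is independent of that size and
`p ∈ cl X ⊆ cl (E − p)`), so `X` extends inside `E − p` to an independent set of size `N − k`, which is captured by
the superset closure. -/
theorem exists_mem_capLevel_superset {p : α} {k : ℕ} (hk : 2 * k < (gr M).card)
    {X : Finset α} (hX : X ∈ capLevel M p k) :
    ∃ X' ∈ capLevel M p ((gr M).card - k), X ⊆ X' := by
  rw [mem_capLevel] at hX
  obtain ⟨hXK, hXk⟩ := hX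
  have hXK' := hXK
  rw [mem_capSets, mem_biIndepAll] at hXK'
  obtain ⟨⟨⟨hXg, hXr, hXc⟩, hpX⟩, hpcl⟩ := hXK'
  have hXE' : X ⊆ (gr M).erase p := by
    intro x hx
    rw [mem_erase]
    exact ⟨fun h => hpX (h ▸ hx), hXg hx⟩
  have hpE' : p ∈ clF M ((gr M).erase p) := mem_clF_of_subset hXE' hpcl
  have hgr_sub : gr M ⊆ clF M ((gr M).erase p) := by
    intro x hx
    by_cases hxp : x = p
    · rw [hxp]
      exact hpE'
    · exact subset_clF_self_of_subset_gr (erase_subset _ _) (mem_erase.2 ⟨hxp, hx⟩)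
  have hrkE' : (gr M).card - k ≤ rk M ((gr M).erase p) := by
    have h1 : rk M (gr M \ X) ≤ rk M (gr M) := rk_le_rk_of_subset_finset sdiff_subset
    have h2 : rk M (gr M) ≤ rk M (clF M ((gr M).erase p)) := rk_le_rk_of_subset_finset hgr_sub
    rw [rk_clF_eq_rk] at h2
    rw [hXc, card_sdiff_of_subset hXg, hXk] at h1
    omega
  have hXind : M.Indep (X : Set α) := indep_of_rk_eq_card' hXr
  have hE'E : (((gr M).erase p : Finset α) : Set α) ⊆ M.E := by
    rw [← coe_gr]
    exact_mod_cast erase_subset p (gr M)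
  obtain ⟨J, hJ, hXJ⟩ := hXind.subset_isBasis_of_subset (by exact_mod_cast hXE') hE'E
  have hJfin : J.Finite := (Finset.finite_toSet _).subset hJ.subset
  have hJ'J : (hJfin.toFinset : Set α) = J := Set.Finite.coe_toFinset hJfin
  have hJ'card : hJfin.toFinset.card = rk M ((gr M).erase p) := by
    have h1 := hJ.encard_eq_eRk
    rw [← hJ'J, Set.encard_coe_eq_coe_finsetCard, ← coe_rk] at h1
    exact_mod_cast h1
  have hXJ' : X ⊆ hJfin.toFinset := by
    intro x hx
    rw [Set.Finite.mem_toFinset]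
    exact hXJ hx
  have hJ'E' : hJfin.toFinset ⊆ (gr M).erase p := by
    intro x hx
    rw [Set.Finite.mem_toFinset] at hx
    exact_mod_cast hJ.subset hx
  obtain ⟨X', hXX', hX'J', hX'card⟩ :=
    exists_subsuperset_card_eq (n := (gr M).card - k) hXJ' (by omega) (by omega)
  refine ⟨X', ?_, hXX'⟩
  rw [mem_capLevel]
  refine ⟨mem_capSets_of_subset hXK hXX' ((hX'J'.trans hJ'E').trans (erase_subset _ _)) ?_ ?_, hX'card⟩
  · intro hpX'
    exact (mem_erase.1 (hJ'E' (hX'J' hpX'))).1 rfl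
  · refine rk_eq_card_of_indep' (hJ.indep.subset ?_)
    rw [← hJ'J]
    exact_mod_cast hX'J'

/-- In particular `κ_k > 0 ⟹ κ_{N−k} > 0` for `2k < N`: no level of (SYM) is vacuously false. -/
theorem capCount_mirror_pos {p : α} {k : ℕ} (hk : 2 * k < (gr M).card)
    (h : 0 < capCount M k p) : 0 < capCount M ((gr M).card - k) p := by
  rw [← card_capLevel, card_pos] at h ⊢
  obtain ⟨X, hX⟩ := h
  obtain ⟨X', hX', -⟩ := exists_mem_capLevel_superset hk hX
  exact ⟨X', hX'⟩

/-- (SUP) in its two forms is one statement. -/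
theorem capSup_iff_capSupHall : CapSup α ↔ CapSupHall α :=
  ⟨capSupHall_of_capSup, capSup_of_capSupHall⟩

end PercRepro.Cogirth
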